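import Summits.BirchSwinnertonDyer.BirchSwinnertonDyer.Theorems.PrintCf2SplitBadTwoLayerShapiroUnramified
import Literature.NumberTheory.GaloisRepresentations.CoinducedDiscreteGaloisModuleProofs
import HarnessLib

/-!
# Crux `PrintCf2.SplitBadTwoRankOneOfFacts` (stmt-BirchSwinnertonDyer-20368), skeleton v13.2, stub S3n′ `stub_pseudoNullFinite_two`,
# S3N-FACTFREE brick R2, file 6a (B2d of `Cruxes/…/R2-BRICKS-w5g7.md` §5, LOCAL HALF): THE DUAL SHAPIRO LIFT `H¹(Ψ) ∘ Sh` IS LOCALLY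
# TRIVIAL / UNRAMIFIED AT `w` IFF THE LAYER CLASS OF THE DUAL MODULE IS SO AT EVERY PLACE OF `K̄^U` ABOVE `w` — and the `D_w`-twin of
# B2a's orbit detection: `loc_w (Sh z) = 0 ⟹ ∀ σ, conjH1 U M σ z ∈ awayKer U M w`

Cell `bsd-print-cf2`, WIDTH seat `bsd-line-cf2-p1-w8` g5 (prover-bsd-line-cf2-p1-w8-g5-0); `--supports stmt-BirchSwinnertonDyer-20368`
(helper, Theses-free). HONEST FRAMING: nothing here closes the crux or a registered stub; BSD is not proved by any of this; no summit
statement is proved by this seat. No definition, no named fact, no `sorry`. Unconditional.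

SETTING (that of B2a/B2c). `K` a number field; `M` a discrete `Γ_K`-module with open stabilisers (`hM`; `ofSMul M hM`, X11b `LocBridge`);
`U ⊴ Γ_K` open of finite index with representatives `s` (`hs`, `hs1`); `Maps(Γ_K ⧸ U, M) = (ofSMul M hM).coind U hU` (`toTopRep = coindFin` by
`rfl`); `Sh` the Shapiro lift; `w` a finite place, `θ_w = absGaloisRestrict K K_w`, `D_w = decomp w = range θ_w`. DUAL DATA: a discrete
`Γ_K`-module `M′` (`hM'`) with an equivariant PERFECT pairing `B : M × M′ → μₙ` (`hB`, `hBbij`; e.g. `M = ℤ/p^m` trivial or sign-twisted,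
`M′ = μ_{p^m}` with the matching twist), whence the tree's summed-pairing duality morphism
`Ψ = coindTateDualMor (ofSMul M hM) (ofSMul M′ hM′) U B : Maps(Γ_K ⧸ U, M′) ⟶ Maps(Γ_K ⧸ U, M)^D` (bijective, `coindTateDualHom_bijective`) and THE
DUAL SHAPIRO LIFT `y′ ↦ H¹(Ψ)(Sh y′) : H¹(U, M′) ⥲ H¹(K, Maps(Γ_K ⧸ U, M)^D)` (`exists_unique_shapiroLift_coindTateDualMor_eq`, Literature).

WHAT.
* §1 `mem_awayKer_iff_exists` (cocycle reading of the line's «locally trivial at `w`», `GreenbergSelmer.awayKer`);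
  `localization_eq_zero_iff_map_eq_zero` (`loc_w x = 0` in the Mackey dialect); **`conjH1_mem_awayKer_of_map_shapiroLift_eq_zero`** /
  **`conjH1_mem_awayKer_of_localization_shapiroLift_eq_zero`** — ORBIT DETECTION ON `D_w`: `loc_w (Sh z) = 0 ⟹ ∀ σ, conjH1 U M σ z ∈ awayKer U M w`
  (the tree's `map_comapCoeffHom_conjMap_eq_zero_of_map_shapiroLift_eq_zero` with `D = Γ_{K_w}`; `U ⊓ D_w = θ_w(θ_w⁻¹U)`).
* §2 `localization_inr_oneCocycleClass`; `exists_principal_iff_of_coindTateDualHom` (pure algebra: «principal on a family of group elements»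
  passes through the bijective equivariant `Ψ`); **`localization_dualShapiro_eq_zero_iff`** (`loc_w (H¹(Ψ)(Sh y′)) = 0 ⟺ loc_w (Sh y′) = 0`),
  **`localization_dualShapiro_mem_unramifiedSubgroup_iff`** (`… ∈ H¹_ur ⟺ … ∈ H¹_ur`); hence
  **`conjH1_mem_awayKer_of_localization_dualShapiro_eq_zero`**, **`conjH1_mem_unramifiedKer_of_localization_dualShapiro_mem`** — a dual class
  locally trivial (resp. unramified) at `w` comes from a layer class `y′ ∈ H¹(U, M′)` locally trivial (resp. unramified) above `w`.
USE: file 6b (`…LayerDualShapiroReading`) reads the canonical dual Selmer conditions `(⊤)^* = 0` / `(H¹_ur)^* = H¹_ur` through these and turns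
B2c's `hkill` into a (PRO-NULL) statement in the line's currency. presearch: NSW (1.6.4)–(1.6.5), Brown III (5.6)(b), Milne ADT I Cor. 2.3 /
§2; bsd-wall precedent `…CoindShapiroOfFun` (one orbit over `ℚ`); no new fact. beyond-print theorem: no.

References: [NeukirchSchmidtWingberg2008] I §5 (1.5.2)–(1.5.7), I §6 (1.6.4)–(1.6.5); [MilneADT2006] I §0, §2, Cor. 2.3; [Brown1982] III §5
(5.6)(b); [SerreGaloisCohomology1997] I §2.4, §5.1, II §6.1; [EmertonPollackWeston2006] §3.1.
-/

noncomputable section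

open scoped Classical ContRepresentation

set_option linter.dupNamespace false
set_option autoImplicit false

open CategoryTheory NumberField IsDedekindDomain Field ValuativeRel
open Literature.NumberTheory.EllipticCurves Literature.NumberTheory.EllipticCurves.GreenbergSelmer
open Literature.NumberTheory.EllipticCurves.GreenbergVatsal2000
open Literature.NumberTheory.GaloisRepresentations
open Literature.NumberTheory.GaloisRepresentations.DiscreteGaloisModule (SelmerStructure mu MuCarrier TateDual tateDual
  coindTateDualMor coindTateDualHom)
open Summit.BirchSwinnertonDyer.Rank1Residual.X11b.LocBridge

namespace Summit.BirchSwinnertonDyer.BirchSwinnertonDyer.Theorems.PrintCf2.LayerShapiro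

variable {K : Type} [Field K] [NumberField K]
variable {M : Type} [AddCommGroup M] [DistribMulAction (absoluteGaloisGroup K) M] [TopologicalSpace M] [DiscreteTopology M]
  (hM : ∀ m : M, IsOpen {σ : absoluteGaloisGroup K | σ • m = m})
  (U : Subgroup (absoluteGaloisGroup K)) [U.Normal] (hU : IsOpen (U : Set (absoluteGaloisGroup K)))
  [Fintype (absoluteGaloisGroup K ⧸ U)] {s : absoluteGaloisGroup K ⧸ U → absoluteGaloisGroup K}
  (hs : ∀ y, (s y : absoluteGaloisGroup K ⧸ U) = y) (hs1 : s ((1 : absoluteGaloisGroup K) : absoluteGaloisGroup K ⧸ U) = 1)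
  (w : HeightOneSpectrum (𝓞 K))

/-! ## §1. The line's «locally trivial at `w`» condition on cocycles, and for the Shapiro lift -/

omit [U.Normal] in
/-- **`[φ] ∈ awayKer H M v` iff `φ` is principal on `H ⊓ D_v`** (the kernel of the restriction to the decomposition subgroup
read on a representing cocycle; `resH1Hom_oneCocycleClass_eq_zero_iff`). [cite: EmertonPollackWeston2006, §3.1]
[cite: SerreGaloisCohomology1997, I §5.1] -/
theorem mem_awayKer_iff_exists (H : Subgroup (absoluteGaloisGroup K)) (v : HeightOneSpectrum (𝓞 K))
    (φ : contOneCocycles (discreteTopRep H M)) :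
    oneCocycleClass _ φ ∈ GreenbergSelmer.awayKer H M v ↔
      ∃ m : M, ∀ x : ↥(H ⊓ decomp (K := K) v), φ.1 (Subgroup.inclusion inf_le_left x) =
        ((x : absoluteGaloisGroup K)) • m - m := by
  rw [GreenbergSelmer.awayKer, AddMonoidHom.mem_ker, resOfLe,
    resH1Hom_oneCocycleClass_eq_zero_iff _ _ _ Function.bijective_id]
  rfl

omit [U.Normal] in
/-- **`loc_w x = 0` iff the pull-back of `x` along `θ_w : Γ_{K_w} → Γ_K` vanishes** — the localisation of the Poitou–Tate files
(`galoisCohomology.localization`) in the Mackey dialect `ContinuousCohomology.map θ_w (𝟙 _) 1 x = 0` of the Shapiro files (both are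
the class of `F ∘ θ_w`). [cite: SerreGaloisCohomology1997, II §6.1] [cite: NeukirchSchmidtWingberg2008, I §5 (1.5.2)] -/
theorem localization_eq_zero_iff_map_eq_zero (x : galoisCohomology ((ofSMul M hM).coind U hU) 1) :
    galoisCohomology.localization ((ofSMul M hM).coind U hU) (Sum.inr w) 1 x = 0 ↔
      ContinuousCohomology.map (absGaloisRestrict K (w.adicCompletion K))
          (𝟙 (TopRep.res
            (absGaloisRestrict K (w.adicCompletion K) : absoluteGaloisGroup (w.adicCompletion K) →* absoluteGaloisGroup K)
            (coindFin (ofSMul M hM).toTopRep U))) 1 x = 0 := by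
  obtain ⟨F, rfl⟩ := oneCocycleClass_surjective ((ofSMul M hM).coind U hU).toTopRep x
  rw [localization_coind_oneCocycleClass]
  refine (oneCocycleClass_eq_zero_iff _ _).trans ?_
  have e := map_oneCocycleClass_eq_zero_iff (coindFin (ofSMul M hM).toTopRep U) _
    (absGaloisRestrict K (w.adicCompletion K)) (𝟙 _) Function.bijective_id F
  refine Iff.trans ?_ e.symm
  constructor
  · rintro ⟨Φ, hΦ⟩
    exact ⟨Φ, fun l ↦ hΦ l⟩
  · rintro ⟨Φ, hΦ⟩
    exact ⟨Φ, fun l ↦ hΦ l⟩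

omit [Fintype (absoluteGaloisGroup K ⧸ U)] in
/-- **(⟹) ORBIT DETECTION ON THE DECOMPOSITION GROUP.** If the pull-back to `Γ_{K_w}` of the Shapiro lift `Sh z` of `z ∈ H¹(U, M)`
vanishes (i.e. `loc_w (Sh z) = 0`), then for EVERY `σ ∈ Γ_K` the conjugate `conjH1 U M σ z` restricts to zero on `U ⊓ D_w`
(`∈ awayKer U M w`) — all places of `F = K̄^U` above `w`: the tree's `map_comapCoeffHom_conjMap_eq_zero_of_map_shapiroLift_eq_zero` with
`D = Γ_{K_w} → Γ_K`, and `U ⊓ D_w = θ_w(θ_w⁻¹U)` (`decomp w = range θ_w`). [cite: NeukirchSchmidtWingberg2008, I §6 Prop. (1.6.4)–(1.6.5)]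
[cite: Brown1982, III §5 (5.6)(b)] -/
theorem conjH1_mem_awayKer_of_map_shapiroLift_eq_zero (z : subgroupH1 U M)
    (h0 : ContinuousCohomology.map (absGaloisRestrict K (w.adicCompletion K))
          (𝟙 (TopRep.res
            (absGaloisRestrict K (w.adicCompletion K) : absoluteGaloisGroup (w.adicCompletion K) →* absoluteGaloisGroup K)
            (coindFin (ofSMul M hM).toTopRep U))) 1 (shapiroLift (ofSMul M hM).toTopRep U hU hs hs1 z) = 0)
    (σ : absoluteGaloisGroup K) : conjH1 U M σ z ∈ GreenbergSelmer.awayKer U M w := by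
  obtain ⟨sD, hsD, hsD1⟩ := exists_reps_one
    (N := U.comap ((absGaloisRestrict K (w.adicCompletion K) :
        absoluteGaloisGroup (w.adicCompletion K) →ₜ* absoluteGaloisGroup K) :
          absoluteGaloisGroup (w.adicCompletion K) →* absoluteGaloisGroup K))
  obtain ⟨f, rfl⟩ := oneCocycleClass_surjective (subgroupRep (ofSMul M hM).toTopRep U) z
  have hdet := map_comapCoeffHom_conjMap_eq_zero_of_map_shapiroLift_eq_zero (ofSMul M hM).toTopRep U
    (absGaloisRestrict K (w.adicCompletion K)) hU hs hs1 hsD hsD1 (oneCocycleClass _ f) h0 σ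
  rw [conjMap_oneCocycleClass, map_oneCocycleClass_eq_zero_iff _ _ _ _ Function.bijective_id] at hdet
  obtain ⟨v, hv⟩ := hdet
  change (conjMap (ofSMul M hM).toTopRep U σ 1).hom (oneCocycleClass _ f) ∈ GreenbergSelmer.awayKer U M w
  rw [conjMap_oneCocycleClass]
  refine (mem_awayKer_iff_exists (M := M) U w _).2 ⟨v, fun x ↦ ?_⟩
  have hxD : ((x : absoluteGaloisGroup K)) ∈ decomp (K := K) w := (Subgroup.mem_inf.1 x.2).2
  have hxU : ((x : absoluteGaloisGroup K)) ∈ U := (Subgroup.mem_inf.1 x.2).1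
  obtain ⟨τ, hτx⟩ := (mem_decomp_iff w _).1 hxD
  have hd : τ ∈ U.comap ((absGaloisRestrict K (w.adicCompletion K) :
        absoluteGaloisGroup (w.adicCompletion K) →ₜ* absoluteGaloisGroup K) :
          absoluteGaloisGroup (w.adicCompletion K) →* absoluteGaloisGroup K) := by
    rw [Subgroup.mem_comap]
    change absGaloisRestrict K (w.adicCompletion K) τ ∈ U
    rw [hτx]
    exact hxU
  have hx : Subgroup.inclusion inf_le_left x =
      comapSubtypeHom U (absGaloisRestrict K (w.adicCompletion K)) ⟨τ, hd⟩ := by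
    apply Subtype.ext
    rw [comapSubtypeHom_apply_coe]
    exact hτx.symm
  rw [hx, hv]
  change (absGaloisRestrict K (w.adicCompletion K) τ) • v - v = _
  rw [hτx]

/-- **`loc_w (Sh z) = 0 ⟹ ∀ σ, conjH1 U M σ z ∈ awayKer U M w`** (the previous theorem with the hypothesis in the localisation
currency of the Poitou–Tate files). [cite: NeukirchSchmidtWingberg2008, I §6 Prop. (1.6.4)–(1.6.5)] -/
theorem conjH1_mem_awayKer_of_localization_shapiroLift_eq_zero (z : subgroupH1 U M)
    (h : galoisCohomology.localization ((ofSMul M hM).coind U hU) (Sum.inr w) 1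
        (shapiroLift (ofSMul M hM).toTopRep U hU hs hs1 z) = 0)
    (σ : absoluteGaloisGroup K) : conjH1 U M σ z ∈ GreenbergSelmer.awayKer U M w :=
  conjH1_mem_awayKer_of_map_shapiroLift_eq_zero hM U hU hs hs1 w z
    ((localization_eq_zero_iff_map_eq_zero hM U hU w _).1 h) σ


/-! ## §2. The dual Shapiro lift `H¹(Ψ) ∘ Sh`: local vanishing and unramifiedness are those of the layer class of the dual module -/

omit [U.Normal] [Fintype (absoluteGaloisGroup K ⧸ U)] in
/-- `loc_w [F] = [F ∘ θ_w]` for any discrete Galois module (`galoisCohomology.res_one_oneCocycleClass` at `K_w`).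
[cite: SerreGaloisCohomology1997, I §2.4] -/
theorem localization_inr_oneCocycleClass {V : Type} [AddCommGroup V] [TopologicalSpace V] [DiscreteTopology V]
    (ρ : DiscreteGaloisModule K V) (F : contOneCocycles ρ.toTopRep) :
    galoisCohomology.localization ρ (Sum.inr w) 1 (oneCocycleClass ρ.toTopRep F) =
      oneCocycleClass (DiscreteGaloisModule.toTopRep (GaloisRep.toLocal w ρ))
        (contOneCocycles.pullback (absGaloisRestrict K (w.adicCompletion K)) (X := ρ.toTopRep)
          (Y := DiscreteGaloisModule.toTopRep (GaloisRep.toLocal w ρ))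
          (TopRep.ofHom ⟨ContinuousLinearMap.id ℤ V, fun _ ↦ rfl⟩) F) :=
  galoisCohomology.res_one_oneCocycleClass (w.adicCompletion K) F

variable {M' : Type} [AddCommGroup M'] [DistribMulAction (absoluteGaloisGroup K) M'] [TopologicalSpace M'] [DiscreteTopology M']
  (hM' : ∀ m : M', IsOpen {σ : absoluteGaloisGroup K | σ • m = m})
  [Finite M] {n : ℕ} (B : M →+ M' →+ MuCarrier K n)
  (hB : ∀ (σ : absoluteGaloisGroup K) (m : M) (m' : M'), B (ofSMul M hM σ m) (ofSMul M' hM' σ m') = mu K n σ (B m m'))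

omit [NumberField K] [U.Normal] in
/-- Transfer of «principal on a family of group elements» through the bijective equivariant duality map
`Ψ = coindTateDualHom U B : Maps(Γ_K ⧸ U, M′) ⥲ Maps(Γ_K ⧸ U, M)^D` (pure algebra: `Ψ` is additive, injective, surjective and
intertwines the two actions, `coindTateDualHom_smul`). [cite: MilneADT2006, Ch. I §0] -/
theorem exists_principal_iff_of_coindTateDualHom
    (hB : ∀ (σ : absoluteGaloisGroup K) (m : M) (m' : M'), B (ofSMul M hM σ m) (ofSMul M' hM' σ m') = mu K n σ (B m m'))
    (hBbij : Function.Bijective fun m' : M' ↦ B.flip m') {ι : Type*} (g : ι → absoluteGaloisGroup K)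
    (c : ι → (absoluteGaloisGroup K ⧸ U → M')) :
    (∃ Φ : TateDual K (absoluteGaloisGroup K ⧸ U → M) n, ∀ i,
        coindTateDualHom U B (c i) = ((ofSMul M hM).coind U hU).tateDual n (g i) Φ - Φ) ↔
      ∃ Φ' : absoluteGaloisGroup K ⧸ U → M', ∀ i, c i = (ofSMul M' hM').coind U hU (g i) Φ' - Φ' := by
  have hΨ := DiscreteGaloisModule.coindTateDualHom_bijective U B hBbij
  constructor
  · rintro ⟨Φ, hΦ⟩
    obtain ⟨Φ', rfl⟩ := hΨ.2 Φ
    refine ⟨Φ', fun i ↦ hΨ.1 ?_⟩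
    rw [hΦ i, map_sub, DiscreteGaloisModule.coindTateDualHom_smul (ofSMul M hM) (ofSMul M' hM') U B hU hB]
  · rintro ⟨Φ', hΦ'⟩
    refine ⟨coindTateDualHom U B Φ', fun i ↦ ?_⟩
    rw [hΦ' i, map_sub, DiscreteGaloisModule.coindTateDualHom_smul (ofSMul M hM) (ofSMul M' hM') U B hU hB]

omit [U.Normal] in
/-- **`loc_w (H¹(Ψ)(Sh y')) = 0 ⟺ loc_w (Sh y') = 0`**: the localisation at `w` of the dual-Shapiro image of a layer class `y' ∈ H¹(U, M′)`
in `H¹(K, Maps(Γ_K ⧸ U, M)^D)` vanishes iff the localisation of the Shapiro lift of `y'` in `H¹(K, Maps(Γ_K ⧸ U, M′))` does (both read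
«the cocycle is principal on `θ_w(Γ_{K_w})`», and `Ψ` is a bijective equivariant map). [cite: MilneADT2006, Ch. I Cor. 2.3]
[cite: NeukirchSchmidtWingberg2008, I §6 Prop. (1.6.4)] -/
theorem localization_dualShapiro_eq_zero_iff (hBbij : Function.Bijective fun m' : M' ↦ B.flip m') (y' : subgroupH1 U M') :
    galoisCohomology.localization (((ofSMul M hM).coind U hU).tateDual n) (Sum.inr w) 1
        (cohomologyMap (coindTateDualMor (ofSMul M hM) (ofSMul M' hM') U B hU hB) 1
          (shapiroLift (ofSMul M' hM').toTopRep U hU hs hs1 y')) = 0 ↔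
      galoisCohomology.localization ((ofSMul M' hM').coind U hU) (Sum.inr w) 1
        (shapiroLift (ofSMul M' hM').toTopRep U hU hs hs1 y') = 0 := by
  obtain ⟨G, hG⟩ := oneCocycleClass_surjective (coindFin (ofSMul M' hM').toTopRep U)
    (shapiroLift (ofSMul M' hM').toTopRep U hU hs hs1 y')
  have hL : galoisCohomology.localization (((ofSMul M hM).coind U hU).tateDual n) (Sum.inr w) 1
        (cohomologyMap (coindTateDualMor (ofSMul M hM) (ofSMul M' hM') U B hU hB) 1
          (shapiroLift (ofSMul M' hM').toTopRep U hU hs hs1 y')) = 0 ↔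
      ∃ Φ : TateDual K (absoluteGaloisGroup K ⧸ U → M) n, ∀ l : absoluteGaloisGroup (w.adicCompletion K),
        coindTateDualHom U B (G.1 (absGaloisRestrict K (w.adicCompletion K) l)) =
          ((ofSMul M hM).coind U hU).tateDual n (absGaloisRestrict K (w.adicCompletion K) l) Φ - Φ := by
    rw [← hG, cohomologyMap_oneCocycleClass, localization_inr_oneCocycleClass]
    refine (oneCocycleClass_eq_zero_iff _ _).trans ?_
    constructor
    · rintro ⟨Φ, hΦ⟩
      exact ⟨Φ, fun l ↦ hΦ l⟩
    · rintro ⟨Φ, hΦ⟩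
      exact ⟨Φ, fun l ↦ hΦ l⟩
  have hR : galoisCohomology.localization ((ofSMul M' hM').coind U hU) (Sum.inr w) 1
        (shapiroLift (ofSMul M' hM').toTopRep U hU hs hs1 y') = 0 ↔
      ∃ Φ' : absoluteGaloisGroup K ⧸ U → M', ∀ l : absoluteGaloisGroup (w.adicCompletion K),
        G.1 (absGaloisRestrict K (w.adicCompletion K) l) =
          (ofSMul M' hM').coind U hU (absGaloisRestrict K (w.adicCompletion K) l) Φ' - Φ' := by
    rw [← hG]
    change galoisCohomology.localization ((ofSMul M' hM').coind U hU) (Sum.inr w) 1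
        (oneCocycleClass ((ofSMul M' hM').coind U hU).toTopRep G) = 0 ↔ _
    rw [localization_inr_oneCocycleClass]
    refine (oneCocycleClass_eq_zero_iff _ _).trans ?_
    constructor
    · rintro ⟨Φ, hΦ⟩
      exact ⟨Φ, fun l ↦ hΦ l⟩
    · rintro ⟨Φ, hΦ⟩
      exact ⟨Φ, fun l ↦ hΦ l⟩
  exact hL.trans ((exists_principal_iff_of_coindTateDualHom hM U hU hM' B hB hBbij _ _).trans hR.symm)

omit [U.Normal] in
/-- **`loc_w (H¹(Ψ)(Sh y')) ∈ H¹_ur ⟺ loc_w (Sh y') ∈ H¹_ur`**: the dual-Shapiro image of `y'` is unramified at `w` iff the Shapiro lift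
of `y'` is (both read «principal on `θ_w(I(K_w))`»). [cite: MilneADT2006, Ch. I §2 (unramified cohomology)]
[cite: NeukirchSchmidtWingberg2008, I §6 Prop. (1.6.4)] -/
theorem localization_dualShapiro_mem_unramifiedSubgroup_iff (hBbij : Function.Bijective fun m' : M' ↦ B.flip m') (y' : subgroupH1 U M') :
    galoisCohomology.localization (((ofSMul M hM).coind U hU).tateDual n) (Sum.inr w) 1
        (cohomologyMap (coindTateDualMor (ofSMul M hM) (ofSMul M' hM') U B hU hB) 1
          (shapiroLift (ofSMul M' hM').toTopRep U hU hs hs1 y')) ∈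
        DiscreteGaloisModule.unramifiedSubgroup (GaloisRep.toLocal w (((ofSMul M hM).coind U hU).tateDual n)) 1 ↔
      galoisCohomology.localization ((ofSMul M' hM').coind U hU) (Sum.inr w) 1
        (shapiroLift (ofSMul M' hM').toTopRep U hU hs hs1 y') ∈
        DiscreteGaloisModule.unramifiedSubgroup (GaloisRep.toLocal w ((ofSMul M' hM').coind U hU)) 1 := by
  obtain ⟨G, hG⟩ := oneCocycleClass_surjective (coindFin (ofSMul M' hM').toTopRep U)
    (shapiroLift (ofSMul M' hM').toTopRep U hU hs hs1 y')
  have hL : galoisCohomology.localization (((ofSMul M hM).coind U hU).tateDual n) (Sum.inr w) 1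
        (cohomologyMap (coindTateDualMor (ofSMul M hM) (ofSMul M' hM') U B hU hB) 1
          (shapiroLift (ofSMul M' hM').toTopRep U hU hs hs1 y')) ∈
        DiscreteGaloisModule.unramifiedSubgroup (GaloisRep.toLocal w (((ofSMul M hM).coind U hU).tateDual n)) 1 ↔
      ∃ Φ : TateDual K (absoluteGaloisGroup K ⧸ U → M) n, ∀ l ∈ ({l | l ∈ absInertia (w.adicCompletion K)} : Set _),
        coindTateDualHom U B (G.1 (absGaloisRestrict K (w.adicCompletion K) l)) =
          ((ofSMul M hM).coind U hU).tateDual n (absGaloisRestrict K (w.adicCompletion K) l) Φ - Φ := by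
    rw [← hG, cohomologyMap_oneCocycleClass, localization_inr_oneCocycleClass]
    refine (DiscreteGaloisModule.oneCocycleClass_mem_unramifiedSubgroup_iff_exists _ _).trans ?_
    constructor
    · rintro ⟨Φ, hΦ⟩
      exact ⟨Φ, fun l hl ↦ hΦ l hl⟩
    · rintro ⟨Φ, hΦ⟩
      exact ⟨Φ, fun l hl ↦ hΦ l hl⟩
  have hR : galoisCohomology.localization ((ofSMul M' hM').coind U hU) (Sum.inr w) 1
        (shapiroLift (ofSMul M' hM').toTopRep U hU hs hs1 y') ∈
        DiscreteGaloisModule.unramifiedSubgroup (GaloisRep.toLocal w ((ofSMul M' hM').coind U hU)) 1 ↔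
      ∃ Φ' : absoluteGaloisGroup K ⧸ U → M', ∀ l ∈ ({l | l ∈ absInertia (w.adicCompletion K)} : Set _),
        G.1 (absGaloisRestrict K (w.adicCompletion K) l) =
          (ofSMul M' hM').coind U hU (absGaloisRestrict K (w.adicCompletion K) l) Φ' - Φ' := by
    rw [← hG]
    change galoisCohomology.localization ((ofSMul M' hM').coind U hU) (Sum.inr w) 1
        (oneCocycleClass ((ofSMul M' hM').coind U hU).toTopRep G) ∈ _ ↔ _
    rw [localization_inr_oneCocycleClass]
    refine (DiscreteGaloisModule.oneCocycleClass_mem_unramifiedSubgroup_iff_exists _ _).trans ?_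
    constructor
    · rintro ⟨Φ, hΦ⟩
      exact ⟨Φ, fun l hl ↦ hΦ l hl⟩
    · rintro ⟨Φ, hΦ⟩
      exact ⟨Φ, fun l hl ↦ hΦ l hl⟩
  refine hL.trans (Iff.trans ?_ hR.symm)
  -- index by the subtype of inertia elements
  have key := exists_principal_iff_of_coindTateDualHom hM U hU hM' B hB hBbij
    (fun l : {l // l ∈ ({l | l ∈ absInertia (w.adicCompletion K)} : Set _)} ↦
      absGaloisRestrict K (w.adicCompletion K) l.1)
    (fun l ↦ G.1 (absGaloisRestrict K (w.adicCompletion K) l.1))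
  constructor
  · rintro ⟨Φ, hΦ⟩
    obtain ⟨Φ', hΦ'⟩ := key.1 ⟨Φ, fun l ↦ hΦ l.1 l.2⟩
    exact ⟨Φ', fun l hl ↦ hΦ' ⟨l, hl⟩⟩
  · rintro ⟨Φ', hΦ'⟩
    obtain ⟨Φ, hΦ⟩ := key.2 ⟨Φ', fun l ↦ hΦ' l.1 l.2⟩
    exact ⟨Φ, fun l hl ↦ hΦ ⟨l, hl⟩⟩

/-- **`loc_w (H¹(Ψ)(Sh y')) = 0 ⟹ ∀ σ, conjH1 U M′ σ y' ∈ awayKer U M′ w`** — a dual class which is LOCALLY TRIVIAL at `w` comes from a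
layer class locally trivial at every place of `K̄^U` above `w`. [cite: NeukirchSchmidtWingberg2008, I §6 Prop. (1.6.4)–(1.6.5)]
[cite: MilneADT2006, Ch. I Cor. 2.3] -/
theorem conjH1_mem_awayKer_of_localization_dualShapiro_eq_zero (hBbij : Function.Bijective fun m' : M' ↦ B.flip m') (y' : subgroupH1 U M')
    (h : galoisCohomology.localization (((ofSMul M hM).coind U hU).tateDual n) (Sum.inr w) 1
        (cohomologyMap (coindTateDualMor (ofSMul M hM) (ofSMul M' hM') U B hU hB) 1
          (shapiroLift (ofSMul M' hM').toTopRep U hU hs hs1 y')) = 0)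
    (σ : absoluteGaloisGroup K) : conjH1 U M' σ y' ∈ GreenbergSelmer.awayKer U M' w :=
  conjH1_mem_awayKer_of_localization_shapiroLift_eq_zero hM' U hU hs hs1 w y'
    ((localization_dualShapiro_eq_zero_iff hM U hU hs hs1 w hM' B hB hBbij y').1 h) σ

/-- **`loc_w (H¹(Ψ)(Sh y')) ∈ H¹_ur ⟹ ∀ σ, conjH1 U M′ σ y' ∈ unramifiedKer U M′ w`** — a dual class UNRAMIFIED at `w` comes from a layer
class unramified at every place of `K̄^U` above `w` (B2a `conjH1_mem_unramifiedKer_of_localization_shapiroLift_mem` for `M′`).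
[cite: NeukirchSchmidtWingberg2008, I §6 Prop. (1.6.4)–(1.6.5)] [cite: MilneADT2006, Ch. I §2] -/
theorem conjH1_mem_unramifiedKer_of_localization_dualShapiro_mem (hBbij : Function.Bijective fun m' : M' ↦ B.flip m') (y' : subgroupH1 U M')
    (h : galoisCohomology.localization (((ofSMul M hM).coind U hU).tateDual n) (Sum.inr w) 1
        (cohomologyMap (coindTateDualMor (ofSMul M hM) (ofSMul M' hM') U B hU hB) 1
          (shapiroLift (ofSMul M' hM').toTopRep U hU hs hs1 y')) ∈
        DiscreteGaloisModule.unramifiedSubgroup (GaloisRep.toLocal w (((ofSMul M hM).coind U hU).tateDual n)) 1)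
    (σ : absoluteGaloisGroup K) : conjH1 U M' σ y' ∈ GreenbergVatsal2000.unramifiedKer U M' w :=
  conjH1_mem_unramifiedKer_of_localization_shapiroLift_mem hM' U hU hs hs1 w y'
    ((localization_dualShapiro_mem_unramifiedSubgroup_iff hM U hU hs hs1 w hM' B hB hBbij y').1 h) σ


end Summit.BirchSwinnertonDyer.BirchSwinnertonDyer.Theorems.PrintCf2.LayerShapiro

end
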